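import Summits.BirchSwinnertonDyer.BirchSwinnertonDyer.Theorems.ClassRecordThreeEulerHalvesAtThreeCartanTorusCubeCutPSModNormU
import Summits.BirchSwinnertonDyer.BirchSwinnertonDyer.Theorems.ClassRecordThreeEulerHalvesAtThreeCartanTorusCubeCutPSLineNine
import HarnessLib

/-!
# Crux 23422 line `cartan` v9, stub (F2a), PRINCIPAL-SERIES half of the torus-cube cut — TRIVIAL QUOTIENT ACTION and ASSEMBLY:
# the mod-3 line `X_M` exists, hence (P1) `P_psNonsplitNormLower`, (P2) `P_psSplitNormSharp`, (P3) `P_psNonsplitNormSharp` BY NAME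

Seat `bsd-stepL-tam3-p1` g21 (LINE OWNER of crux 23422; `--supports stmt-BirchSwinnertonDyer-23422 --as helper`). Fifth and last file of
the construction of the mod-3 line (`W = W 𝓛 f₀ = range Φ̄`, `…PSModW`, `…PSModNormU`):
* `W_triv`: **`ρ̄(g) ȳ − ȳ ∈ W` for all `g`, `ȳ`** (the hypothesis `htriv` of cartan-f2a g0's `PS.hline_of_subspace`) — since
  `X̄ = 𝔽₃ ū₀ ⊕ W` (`PS.hcyc_of_subspace`) it is checked on `u₀ = N_U x₀`: for upper unipotents (exact), lower unipotents `ℓ(s)`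
  (order `q`, and `e^q = e` in `𝔽₃`), scalars (LEMMA Z, `PS.rho_eq_one_of_isScalar`) and `δ = diag(a,1)` (cube relation
  `1 + e + e² = 0 ⇒ e = 1`), then on every `g` by the factorisation `g = ℓ(s)·z·δ^k·u(t)` (`PSMod.upper_triangular_factor`), or
  `u(−1)·ℓ(1)·(…)` when `g₀₀ = 0`;
* `exists_line`: for every prime `q ≥ 5`, `q ≡ 1 (mod 3)` and every Cartan torus lattice `𝓛`, `X_M := red⁻¹(W 𝓛 f₀)` (`f₀` the
  phantom Borel-fixed vector of `…PSModPhantom` for `δ = diag(a,1)`, `a` a generator of `𝔽_q^×`) satisfies `hline ∧ hsimple ∧ hcyc ∧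
  hND ∧ hcube` in the EXACT binder shapes of cartan-f2a g0's reductions `PS.ps*_of_line` (`…PSLine`, `…PSLineSplit`, `…PSLineNine`),
  via the transfer theorems `PS.hline_of_subspace` / `PS.hsimple_of_subspace` / `PS.hcyc_of_subspace` (`…PSModThree`);
* **`psNonsplitNormLower : P_psNonsplitNormLower`**, **`psSplitNormSharp : P_psSplitNormSharp`**, **`psNonsplitNormSharp :
  P_psNonsplitNormSharp`** — the three principal-series inputs of bsd-idea-10 g11's `cubicTorusPeriodRatioAtThreeGeFive_of`
  (`…CartanTorusCubeCut`), with `hU` from `PS.exists_unipotent_sum_eq_zero` (`…PSUnipotent`).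
HONEST FRAMING: statements about integral `GL₂(𝔽_q)`-lattices carrying the cubic-newvector character (pure finite group theory);
S-K1′ `CubicTorusPeriodRatioAtThreeGeFive` is assembled in the next file from (C1)(C2)(P1)(P2)(P3); no summit statement and no route
item is proved here; BSD is proved for no curve. [folklore]
-/

namespace Summit.BirchSwinnertonDyer.BirchSwinnertonDyer.Theorems.CartanTorusCubeCut.PSMod

open Summit.BirchSwinnertonDyer.BirchSwinnertonDyer.Theorems.CartanDegree
open Summit.BirchSwinnertonDyer.BirchSwinnertonDyer.Theorems.CartanTorusCubeCut
open Summit.BirchSwinnertonDyer.BirchSwinnertonDyer.Theorems.CartanTorusCubeCut.PS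
open Summit.BirchSwinnertonDyer.BirchSwinnertonDyer.Theorems.CartanTorusCubeCut.Steinberg
open scoped LinearAlgebra.Projectivization

set_option linter.dupNamespace false
set_option autoImplicit false

noncomputable section

open scoped Classical

variable {q : ℕ} [Fact q.Prime]

section Triv
variable (𝓛 : CartanTorusLattice q) (f₀ : Fin 𝓛.d → ℤ)
variable (u : ZMod q → G q) (hu : ∀ y, ((u y : G q) : Mat q) = !![1, y; 0, 1])

/-! ### The trivial quotient action -/

/-- the lower unipotent element `(1 0; y 1)`. -/
def lGL (y : ZMod q) : G q :=
  Matrix.GeneralLinearGroup.mkOfDetNeZero !![1, 0; y, 1] (by simp [Matrix.det_fin_two])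

/-- the matrix of `lGL y`. -/
theorem lGL_coe (y : ZMod q) : ((lGL y : G q) : Mat q) = !![1, 0; y, 1] := rfl

/-- `ℓ(y) ℓ(y') = ℓ(y + y')`. -/
theorem lGL_mul (y y' : ZMod q) : lGL y * lGL y' = (lGL (y + y') : G q) := by
  apply Units.ext
  rw [Units.val_mul, lGL_coe, lGL_coe, lGL_coe]
  ext i j; fin_cases i <;> fin_cases j <;> simp [Matrix.mul_apply, Fin.sum_univ_two, add_comm]

/-- `ℓ(y)^n = ℓ(n y)`. -/
theorem lGL_pow (y : ZMod q) (n : ℕ) : (lGL y : G q) ^ n = lGL (n • y) := by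
  induction n with
  | zero => apply Units.ext; rw [pow_zero, zero_smul, lGL_coe, Units.val_one]; ext i j; fin_cases i <;> fin_cases j <;> simp
  | succ n ih => rw [pow_succ, ih, lGL_mul, succ_nsmul]

/-- `ℓ(y)^q = 1`. -/
theorem lGL_pow_q (y : ZMod q) : (lGL y : G q) ^ q = 1 := by
  rw [lGL_pow, nsmul_eq_mul, ZMod.natCast_self, zero_mul]
  apply Units.ext; rw [lGL_coe, Units.val_one]; ext i j; fin_cases i <;> fin_cases j <;> simp

include hu

/-- **trivial quotient action**: `ρ̄(g) ȳ − ȳ ∈ W` for every `g` and `ȳ` (`q ≡ 1 (mod 3)`, `a` a generator of `𝔽_q^×`,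
`f₀` phantom for `δ = diag(a,1)`). -/
theorem W_triv (h1 : q % 3 = 1) (hq5 : 5 ≤ q) (hf0 : ¬ ThreeDvd f₀) {a : (ZMod q)ˣ}
    (ha : ∀ b : (ZMod q)ˣ, b ∈ Submonoid.powers a)
    (hstab : ∀ g : G q, (g : Mat q) 1 0 = 0 → ThreeDvd (𝓛.ρ g f₀ - f₀)) :
    ∀ (g : G q) (y : Fin 𝓛.d → ZMod 3), PS.redEnd 𝓛.d (𝓛.ρ g) y - y ∈ W 𝓛 f₀ := by
  have hq3 := not_three_dvd_succ h1
  obtain ⟨x₀, hx₀⟩ := exists_normU_not_mem_W 𝓛 f₀ u hu h1 hf0 hstab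
  set u₀ := (∑ y : ZMod q, 𝓛.ρ (u y)) x₀ with hu₀
  set ub := PS.red 𝓛.d u₀ with hub
  -- decomposition `ȳ = e·ū₀ + w`
  have hXM : u₀ ∉ ((W 𝓛 f₀).restrictScalars ℤ).comap (PS.red 𝓛.d) := by
    rw [PS.mem_comap_red_iff]; exact hx₀
  have hdecomp : ∀ y : Fin 𝓛.d → ZMod 3, ∃ e : ZMod 3, y - e • ub ∈ W 𝓛 f₀ := by
    intro y
    obtain ⟨x, rfl⟩ := PS.red_surjective 𝓛.d y
    obtain ⟨n, hn⟩ := PS.hcyc_of_subspace 𝓛 (W 𝓛 f₀) (finrank_W_add_one 𝓛 f₀ hstab h1 hq3 hf0) u₀ hXM x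
    refine ⟨(n : ZMod 3), ?_⟩
    rw [PS.mem_comap_red_iff, map_sub, map_zsmul] at hn
    rwa [Int.cast_smul_eq_zsmul]
  have hW := W_stable 𝓛 f₀ hstab
  -- `ub`-criterion: a multiple of `ū₀` in `W` is the zero multiple
  have hcrit : ∀ e : ZMod 3, e • ub ∈ W 𝓛 f₀ → e = 0 := by
    intro e he
    by_contra hne
    apply hx₀
    have := (W 𝓛 f₀).smul_mem e⁻¹ he
    rwa [smul_smul, inv_mul_cancel₀ hne, one_smul] at this
  -- `good g` from the value on `ū₀`
  have good_of : ∀ g : G q, PS.redEnd 𝓛.d (𝓛.ρ g) ub - ub ∈ W 𝓛 f₀ →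
      ∀ y, PS.redEnd 𝓛.d (𝓛.ρ g) y - y ∈ W 𝓛 f₀ := by
    intro g hg y
    obtain ⟨e, he⟩ := hdecomp y
    have e1 : PS.redEnd 𝓛.d (𝓛.ρ g) y - y =
        e • (PS.redEnd 𝓛.d (𝓛.ρ g) ub - ub) + (PS.redEnd 𝓛.d (𝓛.ρ g) (y - e • ub) - (y - e • ub)) := by
      rw [map_sub, map_smul, smul_sub]; abel
    rw [e1]
    exact (W 𝓛 f₀).add_mem ((W 𝓛 f₀).smul_mem e hg) ((W 𝓛 f₀).sub_mem (hW g _ he) he)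
  have good_mul : ∀ g h : G q, (∀ y, PS.redEnd 𝓛.d (𝓛.ρ g) y - y ∈ W 𝓛 f₀) →
      (∀ y, PS.redEnd 𝓛.d (𝓛.ρ h) y - y ∈ W 𝓛 f₀) → ∀ y, PS.redEnd 𝓛.d (𝓛.ρ (g * h)) y - y ∈ W 𝓛 f₀ := by
    intro g h hg hh y
    rw [PS.redEnd_rho_mul, Module.End.mul_apply]
    have e1 : PS.redEnd 𝓛.d (𝓛.ρ g) (PS.redEnd 𝓛.d (𝓛.ρ h) y) - y =
        (PS.redEnd 𝓛.d (𝓛.ρ g) (PS.redEnd 𝓛.d (𝓛.ρ h) y) - PS.redEnd 𝓛.d (𝓛.ρ h) y) +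
          (PS.redEnd 𝓛.d (𝓛.ρ h) y - y) := by abel
    rw [e1]
    exact (W 𝓛 f₀).add_mem (hg _) (hh _)
  have good_pow : ∀ g : G q, (∀ y, PS.redEnd 𝓛.d (𝓛.ρ g) y - y ∈ W 𝓛 f₀) →
      ∀ n : ℕ, ∀ y, PS.redEnd 𝓛.d (𝓛.ρ (g ^ n)) y - y ∈ W 𝓛 f₀ := by
    intro g hg n
    induction n with
    | zero => intro y; rw [pow_zero, PS.redEnd_rho_one, Module.End.one_apply, sub_self]; exact (W 𝓛 f₀).zero_mem
    | succ n ih => rw [pow_succ]; exact good_mul _ _ ih hg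
  -- (1) upper unipotents fix `u₀` exactly
  have good_u : ∀ t : ZMod q, ∀ y, PS.redEnd 𝓛.d (𝓛.ρ (u t)) y - y ∈ W 𝓛 f₀ := by
    intro t
    apply good_of
    rw [hub, PS.redEnd_red, hu₀, rho_unipotent_apply_normU u hu, sub_self]
    exact (W 𝓛 f₀).zero_mem
  -- (2) scalars act trivially
  have good_z : ∀ z : (ZMod q)ˣ, ∀ y, PS.redEnd 𝓛.d (𝓛.ρ (diagGL ![z, z])) y - y ∈ W 𝓛 f₀ := by
    intro z y
    rw [PS.rho_eq_one_of_isScalar 𝓛 (PS.isScalarMat_diagGL_const z), PS.redEnd_one, Module.End.one_apply, sub_self]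
    exact (W 𝓛 f₀).zero_mem
  -- (3) elements of order dividing `q` (odd): the eigenvalue `e` on `ū₀` has `e^q = 1`, so `e = 1`
  have hqodd : ∃ k, q = 2 * k + 1 := by
    have hq := (Fact.out : q.Prime).eq_one_or_self_of_dvd 2
    rcases Nat.even_or_odd q with ⟨k, hk⟩ | ⟨k, hk⟩
    · exfalso; have := hq ⟨k, by omega⟩; omega
    · exact ⟨k, hk⟩
  have good_of_pow_q : ∀ g : G q, g ^ q = 1 → ∀ y, PS.redEnd 𝓛.d (𝓛.ρ g) y - y ∈ W 𝓛 f₀ := by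
    intro g hgq
    apply good_of
    obtain ⟨e, he⟩ := hdecomp (PS.redEnd 𝓛.d (𝓛.ρ g) ub)
    -- `ρ̄(g^n) ū₀ − e^n ū₀ ∈ W`
    have hn : ∀ n : ℕ, PS.redEnd 𝓛.d (𝓛.ρ (g ^ n)) ub - e ^ n • ub ∈ W 𝓛 f₀ := by
      intro n
      induction n with
      | zero => rw [pow_zero, pow_zero, PS.redEnd_rho_one, Module.End.one_apply, one_smul, sub_self]
                exact (W 𝓛 f₀).zero_mem
      | succ n ih =>
        have e1 : PS.redEnd 𝓛.d (𝓛.ρ (g ^ (n + 1))) ub - e ^ (n + 1) • ub =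
            PS.redEnd 𝓛.d (𝓛.ρ g) (PS.redEnd 𝓛.d (𝓛.ρ (g ^ n)) ub - e ^ n • ub) +
              e ^ n • (PS.redEnd 𝓛.d (𝓛.ρ g) ub - e • ub) := by
          rw [pow_succ', PS.redEnd_rho_mul, Module.End.mul_apply, map_sub, map_smul, smul_sub, smul_smul, ← pow_succ]
          abel
        rw [e1]
        exact (W 𝓛 f₀).add_mem (hW g _ ih) ((W 𝓛 f₀).smul_mem _ he)
    have hq' := hn q
    rw [hgq, PS.redEnd_rho_one, Module.End.one_apply,
      show ub - e ^ q • ub = (1 - e ^ q) • ub by rw [sub_smul, one_smul]] at hq'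
    · have he1 : (1 : ZMod 3) - e ^ q = 0 := hcrit _ hq'
      obtain ⟨k, hk⟩ := hqodd
      have key : e ^ q = e := by
        rw [hk]
        by_cases he0 : e = 0
        · rw [he0, zero_pow (by omega)]
        · have h2 : e ^ 2 = 1 := by simpa using ZMod.pow_card_sub_one_eq_one he0
          rw [pow_succ, pow_mul, h2, one_pow, one_mul]
      have he' : e = 1 := by rw [key] at he1; linear_combination -he1
      rwa [he', one_smul] at he
  -- (4) `δ = diag(a,1)`: cube relation
  have hδcube : u₀ + 𝓛.ρ (diagGL ![a, 1]) u₀ + 𝓛.ρ (diagGL ![a, 1]) (𝓛.ρ (diagGL ![a, 1]) u₀) = 0 :=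
    PS.cube_relation_of_unipotentFixed u hu 𝓛 h1 (generator_not_cube h1 ha) u₀
      (fun g h10 h00 h11 => normU_fixed 𝓛 u hu x₀ g h10 h00 h11)
  have good_δ : ∀ y, PS.redEnd 𝓛.d (𝓛.ρ (diagGL ![a, 1])) y - y ∈ W 𝓛 f₀ := by
    apply good_of
    set M := PS.redEnd 𝓛.d (𝓛.ρ (diagGL ![a, 1])) with hM
    obtain ⟨e, he⟩ := hdecomp (M ub)
    have hred : ub + M ub + M (M ub) = 0 := by
      have := congrArg (PS.red 𝓛.d) hδcube
      have e2 : PS.red 𝓛.d (𝓛.ρ (diagGL ![a, 1]) u₀) = M ub := (PS.redEnd_red 𝓛.d _ u₀).symm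
      have e3 : PS.red 𝓛.d (𝓛.ρ (diagGL ![a, 1]) (𝓛.ρ (diagGL ![a, 1]) u₀)) = M (M ub) := by
        rw [← PS.redEnd_red 𝓛.d (𝓛.ρ (diagGL ![a, 1])) (𝓛.ρ (diagGL ![a, 1]) u₀), e2]
      rw [map_add, map_add, map_zero, e3, e2] at this
      exact this
    have hmem : (1 + e + e ^ 2) • ub ∈ W 𝓛 f₀ := by
      have e1 : (1 + e + e ^ 2) • ub = (ub + M ub + M (M ub)) - ((M ub - e • ub) + (M (M ub - e • ub) + e • (M ub - e • ub))) := by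
        rw [map_sub, map_smul]; simp only [add_smul, one_smul, smul_sub, smul_smul, pow_two]; abel
      rw [e1, hred, zero_sub]
      exact (W 𝓛 f₀).neg_mem ((W 𝓛 f₀).add_mem he ((W 𝓛 f₀).add_mem (hW _ _ he) ((W 𝓛 f₀).smul_mem _ he)))
    have he' : e = 1 := by
      have h0 := hcrit _ hmem
      by_cases he0 : e = 0
      · rw [he0] at h0; norm_num at h0
      · have h2 : e ^ 2 = 1 := by simpa using ZMod.pow_card_sub_one_eq_one he0
        rw [h2] at h0
        have : e = -2 := by linear_combination h0
        rw [this]; decide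
    rwa [he', one_smul] at he
  -- (5) every element: factorisation
  intro g
  by_cases h00 : (g : Mat q) 0 0 = 0
  · -- `g = u(−1)·(u(1)·g)` with `(u(1)·g)₀₀ = g₁₀ ≠ 0`
    have h10 : (g : Mat q) 1 0 ≠ 0 := by
      intro h10
      have hdet : (g : Mat q).det = 0 := by rw [Matrix.det_fin_two, h00, h10]; ring
      exact (Matrix.isUnit_iff_isUnit_det _ |>.1 (Units.isUnit g)).ne_zero hdet
    set g' := u 1 * g with hg'
    have hg'00 : ((g' : G q) : Mat q) 0 0 ≠ 0 := by
      rw [hg', Units.val_mul, hu]; simp [Matrix.mul_apply, Fin.sum_univ_two, h00]; exact h10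
    have hg'10 : ((lGL (-(((g' : G q) : Mat q) 1 0 * (((g' : G q) : Mat q) 0 0)⁻¹)) * g' : G q) : Mat q) 1 0 = 0 := by
      rw [Units.val_mul, lGL_coe]; simp [Matrix.mul_apply, Fin.sum_univ_two]; field_simp; ring
    obtain ⟨z, k, t, hfac⟩ := upper_triangular_factor u hu a ha hg'10
    have e1 : g = u (-1) * (lGL (((g' : G q) : Mat q) 1 0 * (((g' : G q) : Mat q) 0 0)⁻¹) *
        (diagGL ![z, z] * (diagGL ![a, 1] ^ k * u t))) := by
      rw [← hfac, ← mul_assoc (lGL _), lGL_mul, add_neg_cancel, show (lGL 0 : G q) = 1 by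
        apply Units.ext; rw [lGL_coe, Units.val_one]; ext i j; fin_cases i <;> fin_cases j <;> simp, one_mul, hg',
        ← mul_assoc, unipotentParam_mul u hu, neg_add_cancel,
        show (u 0 : G q) = 1 by apply Units.ext; rw [hu, Units.val_one]; ext i j; fin_cases i <;> fin_cases j <;> simp,
        one_mul]
    rw [e1]
    refine good_mul _ _ (good_u (-1)) (good_mul _ _ (good_of_pow_q _ (lGL_pow_q _))
      (good_mul _ _ (good_z z) (good_mul _ _ (good_pow _ good_δ k) (good_u t))))
  · have hg10 : ((lGL (-((g : Mat q) 1 0 * ((g : Mat q) 0 0)⁻¹)) * g : G q) : Mat q) 1 0 = 0 := by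
      rw [Units.val_mul, lGL_coe]; simp [Matrix.mul_apply, Fin.sum_univ_two]; field_simp; ring
    obtain ⟨z, k, t, hfac⟩ := upper_triangular_factor u hu a ha hg10
    have e1 : g = lGL ((g : Mat q) 1 0 * ((g : Mat q) 0 0)⁻¹) * (diagGL ![z, z] * (diagGL ![a, 1] ^ k * u t)) := by
      rw [← hfac, ← mul_assoc, lGL_mul, add_neg_cancel, show (lGL 0 : G q) = 1 by
        apply Units.ext; rw [lGL_coe, Units.val_one]; ext i j; fin_cases i <;> fin_cases j <;> simp, one_mul]
    rw [e1]
    exact good_mul _ _ (good_of_pow_q _ (lGL_pow_q _))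
      (good_mul _ _ (good_z z) (good_mul _ _ (good_pow _ good_δ k) (good_u t)))

end Triv

/-! ### Assembly -/

/-- **the mod-3 line exists**: some `X_M ≤ X` satisfies `hline`, `hsimple`, `hcyc`, `hND`, `hcube` (`q ≥ 5`, `q ≡ 1 (mod 3)`). -/
theorem exists_line (hq5 : 5 ≤ q) (h1 : q % 3 = 1) (𝓛 : CartanTorusLattice q) :
    ∃ XM : Submodule ℤ (Fin 𝓛.d → ℤ),
      ((∀ g : G q, ∀ x ∈ XM, 𝓛.ρ g x ∈ XM) ∧ (∀ x, (3 : ℤ) • x ∈ XM) ∧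
        (∀ (g : G q) (x : Fin 𝓛.d → ℤ), 𝓛.ρ g x - x ∈ XM) ∧ XM ≠ ⊤) ∧
      (∀ L : Submodule ℤ (Fin 𝓛.d → ℤ), (∀ g : G q, ∀ x ∈ L, 𝓛.ρ g x ∈ L) →
        (∀ x, (3 : ℤ) • x ∈ L) → L ≤ XM → (L = XM ∨ ∀ x ∈ L, ∃ y, x = (3 : ℤ) • y)) ∧
      (∀ x, x ∉ XM → ∀ y, ∃ a : ℤ, y - a • x ∈ XM) ∧
      (∃ x ∈ XM, ¬ ∃ y, (∑ a : (ZMod q)ˣ, 𝓛.ρ (diagGL ![a, 1]) x) = (3 : ℤ) • y) ∧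
      (∃ (d₀ : G q) (u₀ : Fin 𝓛.d → ℤ), u₀ ∉ XM ∧ u₀ + 𝓛.ρ d₀ u₀ + 𝓛.ρ d₀ (𝓛.ρ d₀ u₀) = 0) := by
  obtain ⟨u, hu⟩ := PS.exists_unipotentParam (q := q)
  obtain ⟨a, ha⟩ := IsCyclic.exists_monoid_generator (α := (ZMod q)ˣ)
  obtain ⟨f₀, hfU, hf0, hfδ⟩ := exists_phantom u hu 𝓛 h1 a
  have hstab : ∀ g : G q, (g : Mat q) 1 0 = 0 → ThreeDvd (𝓛.ρ g f₀ - f₀) :=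
    fun g hg => phantom_stab u hu 𝓛 a ha hfU hfδ hg
  have hq3 := not_three_dvd_succ h1
  refine ⟨((W 𝓛 f₀).restrictScalars ℤ).comap (PS.red 𝓛.d), ?_, ?_, ?_, ?_, ?_⟩
  · exact PS.hline_of_subspace 𝓛 (W 𝓛 f₀) (W_stable 𝓛 f₀ hstab) (W_triv 𝓛 f₀ u hu h1 hq5 hf0 ha hstab)
      (W_ne_top 𝓛 f₀ hstab h1 hq3 hf0)
  · exact PS.hsimple_of_subspace 𝓛 (W 𝓛 f₀) (W_simple 𝓛 f₀ hstab hq3)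
  · exact PS.hcyc_of_subspace 𝓛 (W 𝓛 f₀) (finrank_W_add_one 𝓛 f₀ hstab h1 hq3 hf0)
  · exact exists_hND 𝓛 f₀ h1 hf0 hstab
  · exact exists_hcube 𝓛 f₀ u hu h1 hf0 hstab (generator_not_cube h1 ha)

/-- **(P1)** `P_psNonsplitNormLower`: `3^{v₃(q−1)+1} ∣ m` whenever `N_C(ρ(g) w_s) = m·w_C` (`q ≡ 1 (mod 3)`). -/
theorem psNonsplitNormLower : P_psNonsplitNormLower := by
  intro q _ hq5 h1 𝓛 wS wC hS hSgen _ hCgen g m hm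
  obtain ⟨XM, hline, -, -, -, -⟩ := exists_line hq5 h1 𝓛
  exact PS.psNonsplitNormLower_of_line 𝓛 h1 hline (PS.exists_unipotent_sum_eq_zero 𝓛 h1 hS hSgen) hCgen g m hm

/-- **(P2)** `P_psSplitNormSharp`: some `g` has `3^{v₃(q−1)+1} ∤ m` whenever `N_{T_s}(ρ(g) w_C) = m·w_s` (`q ≡ 1 (mod 3)`). -/
theorem psSplitNormSharp : P_psSplitNormSharp := by
  intro q _ hq5 h1 𝓛 wS wC _ hSgen hC hCgen
  obtain ⟨XM, hline, hsimple, -, hND, -⟩ := exists_line hq5 h1 𝓛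
  exact PS.psSplitNormSharp_of_line 𝓛 h1 hline hsimple hND hSgen hC hCgen

/-- **(P3)** `P_psNonsplitNormSharp`: some `g` has `3^{v₃(q−1)+2} ∤ m` for `N_C(ρ(g⁻¹) w_s) = m·w_C` and `3^{v₃(q−1)} ∣ m` for
`N_{T_s}(ρ(g) w_C) = m·w_s` (`q ≡ 1 (mod 3)`). -/
theorem psNonsplitNormSharp : P_psNonsplitNormSharp := by
  intro q _ hq5 h1 𝓛 wS wC hS hSgen hC hCgen
  obtain ⟨XM, hline, hsimple, hcyc, -, hcube⟩ := exists_line hq5 h1 𝓛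
  exact PS.psNonsplitNormSharp_of_line 𝓛 h1 hline hsimple hcyc hS hSgen hC hCgen
    (PS.exists_unipotent_sum_eq_zero 𝓛 h1 hS hSgen) hcube

end

end Summit.BirchSwinnertonDyer.BirchSwinnertonDyer.Theorems.CartanTorusCubeCut.PSMod
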